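import Summits.ResolutionOfSingularities.ResolutionOfSingularities.Theorems.FrobeniusLadderFRationalResolutionEtaleChartTwoStep
import Summits.ResolutionOfSingularities.ResolutionOfSingularities.Theorems.FrobeniusLadderFRationalResolutionCompletedBaseChangeFibreDownCompletion
import Summits.ResolutionOfSingularities.ResolutionOfSingularities.Theorems.FrobeniusLadderFRationalResolutionCompletedBaseChangeFibreAssembly
import HarnessLib

/-!
# Crux `FrobeniusLadder.FRationalResolution` (stmt-ResolutionOfSingularities-15317), line `redirect`,
# stub `stub_diagonalizableQuotientResolution` — THE NO-GALOIS NAIVE TWO-STEP PIPELINE ASSEMBLED: **`hloc` at an isolated singular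
# point from chart-level facts on a MODEL `T` with `(T_𝔳)^ ≅ (C_𝔔)^` for an ÉTALE chart ring `C`** (étale counterpart of
# `…CompletedBaseChangeFibreAssembly.hloc_of_model_charts`, p842416)

Pipeline: model chart facts on `T[𝔳^{a+1}/x_i]` ⇒ two-step datum on `Bl_{𝔳^{a+1}(T_𝔳)^}(Spec (T_𝔳)^)` (`…Finite`, `…Points`, UP) ⇒
transport along `e : (T_𝔳)^ ≅ (C_𝔔)^` (`…Transport`) ⇒ DOWN through the completion to `Bl_{𝔭^{a+1}C}(Spec C)` over `V(𝔔)`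
(`…DownCompletion`, p842961; G-ring-free descent p842938) ⇒ two-step étale descent (`…EtaleChartTwoStep`, p842696: comparison
`Bl_{𝔭^{a+1}C}(Spec C) → Bl_{𝔭^{a+1}}(Spec B)`, one-step étale descent at each singular point, `…TwoStepHloc`).

* ★ `hloc_of_two_step_etale_ring_data_of_down` — the ring-data form of p842696 with the datum ALREADY on `Bl_{𝔭^{a+1}C}(Spec C)` over
  `V(𝔔)` (finitely many singular points there, point blow-ups of the stalks regular);
* ★★★ `hloc_of_model_charts_etale` — `B` a domain of finite type over `K`, `ι : Spec B → X` an affine open through the isolated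
  singular point `x = ι 𝔭`, `C` an étale `B`-algebra with a prime `𝔔` over `𝔭`; a model `T` of finite type over a field `κ`, `𝔳`
  maximal, `Spec T` regular at the primes `⊊ 𝔳`, `e : (T_𝔳)^ ≃+* (C_𝔔)^`, generators `x_i` of `𝔳^{a+1}` and ON THE MODEL CHART RINGS
  `T[𝔳^{a+1}/x_i]`: finitely many non-regular primes over `V(𝔳)`, each with regular point blow-up ⇒ `hloc` at `x`.
  NO Galois closure, NO residue-field condition, NO (E)-item: for the diagonalizable-quotient points `C` is the quotient chart ring and
  `T = κ(𝔔)[P]` (g19/g20 `…MonomialAlgebraCompletion` / `…FixedPointCompletionChart` give `e`).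

Honest label: assembly toward ONE leaf stub (no stub, crux or summit closed). No definitions, no named facts, no sorry.
[cite: Kollar2007, §2.2] [cite: Matsumura1987, Thm. 8.11; Thm. 8.14; Thm. 23.7] [cite: StacksProject, Tag 0804; Tag 080B] [cite: GortzWedhorn2020, Prop. 13.91]
-/

noncomputable section

-- single-problem summit: the doubled namespace component is forced
set_option linter.dupNamespace false

open CategoryTheory AlgebraicGeometry TopologicalSpace IsLocalRing
open scoped TensorProduct
open Literature.AlgebraicGeometry.Resolution

namespace Summit.ResolutionOfSingularities.ResolutionOfSingularities.Theorems.FRationalResolution.EtaleChartTwoStepModel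

/-! ## §1 Ring-data form with the datum downstairs -/

/-- ★ **Two-step étale descent, ring-data form, datum on `Bl_{𝔭^{a+1}C}(Spec C)` over `V(𝔔)`.** As
`…EtaleChartTwoStep.hloc_of_two_step_etale_ring_data` (p842696) with the two-step datum given directly downstairs: finitely many
singular points of `Bl_{𝔭^{a+1}C}(Spec C)` over `V(𝔔)`, and `Bl_{𝔪_z}(Spec 𝒪_z)` regular at each of them.
[cite: Kollar2007, §2.2] [cite: Matsumura1987, Thm. 23.7] [cite: StacksProject, Tag 0804] -/
theorem hloc_of_two_step_etale_ring_data_of_down (k : Type) [Field k] (X : Scheme.{0}) [IsIntegral X]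
    (f : X ⟶ Spec (.of k)) [LocallyOfFiniteType f]
    {B C : Type} [CommRing B] [CommRing C] [IsDomain B] [Algebra k B] [Algebra.FiniteType k B]
    [Algebra B C] [Algebra.Etale B C]
    (ι : Spec (.of B) ⟶ X) [IsOpenImmersion ι] (hι : ι ≫ f = Spec.map (CommRingCat.ofHom (algebraMap k B)))
    (𝔭 : Ideal B) [h𝔭 : 𝔭.IsMaximal] (h𝔭0 : 𝔭 ≠ ⊥)
    (hsing : ι ⟨𝔭, h𝔭.isPrime⟩ ∉ Scheme.regularLocus X)
    (hregB : ∀ P : Spec (.of B), P.asIdeal ≠ 𝔭 → P ∈ Scheme.regularLocus (Spec (.of B)))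
    (𝔔 : Ideal C) [h𝔔 : 𝔔.IsPrime] (h𝔔𝔭 : 𝔔.comap (algebraMap B C) = 𝔭) (a : ℕ)
    (hdown_fin : {z : affineBlowup ((𝔭 ^ (a + 1)).map (algebraMap B C)) |
      𝔔 ≤ (affineBlowup.π ((𝔭 ^ (a + 1)).map (algebraMap B C)) z).asIdeal ∧
        ¬ IsRegularLocalRing ((affineBlowup ((𝔭 ^ (a + 1)).map (algebraMap B C))).presheaf.stalk z)}.Finite)
    (hdown_loc : ∀ z : affineBlowup ((𝔭 ^ (a + 1)).map (algebraMap B C)),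
      𝔔 ≤ (affineBlowup.π ((𝔭 ^ (a + 1)).map (algebraMap B C)) z).asIdeal →
      ¬ IsRegularLocalRing ((affineBlowup ((𝔭 ^ (a + 1)).map (algebraMap B C))).presheaf.stalk z) →
      Scheme.IsRegular (affineBlowup (R := (affineBlowup ((𝔭 ^ (a + 1)).map (algebraMap B C))).presheaf.stalk z)
        (maximalIdeal _))) :
    ∃ (V : X.Opens), ι ⟨𝔭, h𝔭.isPrime⟩ ∈ V ∧
      (∀ t : X, t ∉ Scheme.regularLocus X → t ∈ V → t = ι ⟨𝔭, h𝔭.isPrime⟩) ∧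
      ∃ (Y : Scheme.{0}) (ρ : Y ⟶ V), IsProper ρ ∧ Scheme.IsRegular Y ∧
        IsIso (ρ ∣_ (V.ι ⁻¹ᵁ ⟨Scheme.regularLocus X, isOpen_regularLocus_of_locallyOfFiniteType_field f⟩)) ∧
        Dense ((ρ ⁻¹ᵁ (V.ι ⁻¹ᵁ ⟨Scheme.regularLocus X,
          isOpen_regularLocus_of_locallyOfFiniteType_field f⟩) : Y.Opens) : Set Y) := by
  classical
  haveI : IsNoetherianRing B := Algebra.FiniteType.isNoetherianRing k B
  haveI : Algebra.FiniteType B C := inferInstance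
  haveI : IsNoetherianRing C := Algebra.FiniteType.isNoetherianRing B C
  have hI0 : 𝔭 ^ (a + 1) ≠ ⊥ := pow_ne_zero _ h𝔭0
  have hI𝔭 : 𝔭 ^ (a + 1) ≤ 𝔭 := Ideal.pow_le_self (Nat.succ_ne_zero a)
  -- the blow-up `X₁ = Bl_{𝔭^{a+1}}(Spec B)` and the étale comparison `Φ`
  obtain ⟨f₁, hf₁⟩ : ∃ f₁ : affineBlowup (𝔭 ^ (a + 1)) ⟶ Spec (.of k),
      f₁ = affineBlowup.π (𝔭 ^ (a + 1)) ≫ Spec.map (CommRingCat.ofHom (algebraMap k B)) := ⟨_, rfl⟩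
  haveI : LocallyOfFiniteType (Spec.map (CommRingCat.ofHom (algebraMap k B))) := by
    rw [HasRingHomProperty.Spec_iff (P := @LocallyOfFiniteType), CommRingCat.hom_ofHom]
    exact RingHom.finiteType_algebraMap.mpr inferInstance
  haveI : LocallyOfFiniteType f₁ := by rw [hf₁]; infer_instance
  haveI : IsIntegral (affineBlowup (𝔭 ^ (a + 1))) := affineBlowup.isIntegral hI0
  have hopen₁ : IsOpen (Scheme.regularLocus (affineBlowup (𝔭 ^ (a + 1)))) :=
    isOpen_regularLocus_of_locallyOfFiniteType_field f₁
  have hopenB : IsOpen (Scheme.regularLocus (Spec (.of B))) :=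
    isOpen_regularLocus_of_locallyOfFiniteType_field (Spec.map (CommRingCat.ofHom (algebraMap k B)))
  have hφet : (algebraMap B C).Etale := RingHom.etale_algebraMap.mpr inferInstance
  obtain ⟨Φ, hΦet, -, hΦreg, hΦsurj⟩ :=
    EtaleBlowupComparison.exists_etale_comparison (algebraMap B C) hφet (𝔭 ^ (a + 1))
  haveI := hΦet
  have hz𝔔 : Spec.map (CommRingCat.ofHom (algebraMap B C)) (⟨𝔔, h𝔔⟩ : Spec (.of C)) = ⟨𝔭, h𝔭.isPrime⟩ :=
    PrimeSpectrum.ext h𝔔𝔭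
  -- every singular point of `X₁` lies over `𝔭` and lifts along `Φ` to a singular point over `𝔔`
  have hclass : ∀ z₁ : affineBlowup (𝔭 ^ (a + 1)), z₁ ∉ Scheme.regularLocus (affineBlowup (𝔭 ^ (a + 1))) →
      ∃ z' : affineBlowup ((𝔭 ^ (a + 1)).map (algebraMap B C)), Φ z' = z₁ ∧
        𝔔 ≤ (affineBlowup.π ((𝔭 ^ (a + 1)).map (algebraMap B C)) z').asIdeal ∧
        ¬ IsRegularLocalRing ((affineBlowup ((𝔭 ^ (a + 1)).map (algebraMap B C))).presheaf.stalk z') := by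
    intro z₁ hz₁
    have hover : 𝔭 ^ (a + 1) ≤ (affineBlowup.π (𝔭 ^ (a + 1)) z₁).asIdeal := by
      by_contra hnot
      apply hz₁
      refine BlowupRegularOffCentre.preimage_iSup_le_regularLocus (𝔭 ^ (a + 1)) hopen₁ hopenB
        (fun P hP => hregB P ?_) z₁ ?_
      · intro heq
        apply hP
        rw [heq]
        exact hI𝔭
      · obtain ⟨b, hbI, hbz⟩ := SetLike.not_le_iff_exists.mp hnot
        exact Opens.mem_iSup.mpr ⟨⟨b, hbI⟩, (PrimeSpectrum.mem_basicOpen _ _).mpr hbz⟩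
    have h𝔭le : 𝔭 ≤ (affineBlowup.π (𝔭 ^ (a + 1)) z₁).asIdeal := Ideal.IsPrime.le_of_pow_le hover
    have hπz₁ : affineBlowup.π (𝔭 ^ (a + 1)) z₁ = ⟨𝔭, h𝔭.isPrime⟩ :=
      PrimeSpectrum.ext ((h𝔭.eq_of_le (affineBlowup.π (𝔭 ^ (a + 1)) z₁).isPrime.ne_top h𝔭le).symm)
    obtain ⟨z', hz'z, hz'π⟩ := hΦsurj z₁ ⟨𝔔, h𝔔⟩ (by rw [hπz₁, hz𝔔])
    refine ⟨z', hz'z, ?_, ?_⟩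
    · rw [hz'π]
    · intro hreg
      apply hz₁
      rw [← hz'z]
      exact (hΦreg z').mp hreg
  -- `Sing X₁` is finite
  have hfin₁ : (Scheme.regularLocus (affineBlowup (𝔭 ^ (a + 1))))ᶜ.Finite := by
    refine (hdown_fin.image Φ).subset ?_
    intro z₁ hz₁
    obtain ⟨z', hz'z, hz'𝔔, hz's⟩ := hclass z₁ hz₁
    exact ⟨z', ⟨hz'𝔔, hz's⟩, hz'z⟩
  -- `hloc` at every singular point of `X₁`: one-step étale descent along `Φ`
  have hloc₁ : ∀ z₁ : affineBlowup (𝔭 ^ (a + 1)), z₁ ∉ Scheme.regularLocus (affineBlowup (𝔭 ^ (a + 1))) →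
      ∃ (V : (affineBlowup (𝔭 ^ (a + 1))).Opens), z₁ ∈ V ∧
        (∀ t : affineBlowup (𝔭 ^ (a + 1)), t ∉ Scheme.regularLocus (affineBlowup (𝔭 ^ (a + 1))) → t ∈ V → t = z₁) ∧
        ∃ (Y' : Scheme.{0}) (ρ' : Y' ⟶ V), IsProper ρ' ∧ Scheme.IsRegular Y' ∧
          IsIso (ρ' ∣_ (V.ι ⁻¹ᵁ ⟨Scheme.regularLocus (affineBlowup (𝔭 ^ (a + 1))), hopen₁⟩)) ∧
          Dense ((ρ' ⁻¹ᵁ (V.ι ⁻¹ᵁ ⟨Scheme.regularLocus (affineBlowup (𝔭 ^ (a + 1))), hopen₁⟩) : Y'.Opens) :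
            Set Y') := by
    intro z₁ hz₁
    obtain ⟨z', hz'z, hz'𝔔, hz's⟩ := hclass z₁ hz₁
    have hbl := hdown_loc z' hz'𝔔 hz's
    have hx₁ : Φ z' ∉ Scheme.regularLocus (affineBlowup (𝔭 ^ (a + 1))) := by rw [hz'z]; exact hz₁
    have key := EtaleChartStalkBlowup.hloc_of_etale_chart_stalkBlowup k (affineBlowup (𝔭 ^ (a + 1))) f₁ hfin₁ Φ z'
      hx₁ hbl
    rw [hz'z] at key
    exact key
  -- conclude by the two-step model on `Spec B`
  have hsingB : (⟨𝔭, h𝔭.isPrime⟩ : Spec (.of B)) ∉ Scheme.regularLocus (Spec (.of B)) :=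
    fun hreg => hsing ((mem_regularLocus_iff_of_flat_of_isPreimmersion ι _).mp hreg)
  have hRegI : ∀ P : Spec (.of B), P ∈ Scheme.regularLocus (Spec (.of B)) ↔ ¬ 𝔭 ^ (a + 1) ≤ P.asIdeal := by
    intro P
    constructor
    · intro hP hle
      have : P = ⟨𝔭, h𝔭.isPrime⟩ :=
        PrimeSpectrum.ext (h𝔭.eq_of_le P.isPrime.ne_top (Ideal.IsPrime.le_of_pow_le hle)).symm
      rw [this] at hP
      exact hsingB hP
    · intro hnle
      refine hregB P (fun heq => hnle ?_)
      rw [heq]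
      exact hI𝔭
  have hq : ∀ t : Spec (.of B), 𝔭 ^ (a + 1) ≤ t.asIdeal → t = ⟨𝔭, h𝔭.isPrime⟩ := fun t ht =>
    PrimeSpectrum.ext (h𝔭.eq_of_le t.isPrime.ne_top (Ideal.IsPrime.le_of_pow_le ht)).symm
  exact TwoStepHloc.hloc_of_two_step_affineOpen k X f B ι hι (𝔭 ^ (a + 1)) (IsNoetherian.noetherian _) hI0 hRegI
    ⟨𝔭, h𝔭.isPrime⟩ hq hopen₁ hfin₁ hloc₁

/-! ## §2 The model assembly -/

/-- ★★★ **`hloc` AT AN ISOLATED SINGULAR POINT FROM THE MODEL CHARTS, VIA AN ÉTALE CHART (no Galois data).** See the module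
docstring. [cite: Kollar2007, §2.2] [cite: Matsumura1987, Thm. 8.11; Thm. 8.14; Thm. 23.7] [cite: StacksProject, Tag 0804; Tag 080B] -/
theorem hloc_of_model_charts_etale (K : Type) [Field K] (X : Scheme.{0}) [IsIntegral X]
    (f : X ⟶ Spec (.of K)) [LocallyOfFiniteType f]
    {B C : Type} [CommRing B] [CommRing C] [IsDomain B] [Algebra K B] [Algebra.FiniteType K B]
    [Algebra B C] [Algebra.Etale B C]
    (ι : Spec (.of B) ⟶ X) [IsOpenImmersion ι] (hι : ι ≫ f = Spec.map (CommRingCat.ofHom (algebraMap K B)))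
    (𝔭 : Ideal B) [h𝔭 : 𝔭.IsMaximal] (h𝔭0 : 𝔭 ≠ ⊥)
    (hsing : ι ⟨𝔭, h𝔭.isPrime⟩ ∉ Scheme.regularLocus X)
    (hregB : ∀ P : Spec (.of B), P.asIdeal ≠ 𝔭 → P ∈ Scheme.regularLocus (Spec (.of B)))
    (𝔔 : Ideal C) [h𝔔 : 𝔔.IsPrime] (h𝔔𝔭 : 𝔔.comap (algebraMap B C) = 𝔭) (a : ℕ)
    -- the model
    (κ : Type) [Field κ] (T : Type) [CommRing T] [Algebra κ T] [Algebra.FiniteType κ T] (𝔳 : Ideal T) [𝔳.IsMaximal]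
    (hoff : ∀ t : Spec (.of T), t.asIdeal ≤ 𝔳 → t.asIdeal ≠ 𝔳 → t ∈ Scheme.regularLocus (Spec (.of T)))
    (e : (AdicCompletion (maximalIdeal (Localization.AtPrime 𝔳)) (Localization.AtPrime 𝔳)) ≃+* (AdicCompletion (maximalIdeal (Localization.AtPrime 𝔔)) (Localization.AtPrime 𝔔)))
    {n : ℕ} (x : Fin n → T) (hx : 𝔳 ^ (a + 1) = Ideal.span (Set.range x))
    (hfin : ∀ i : Fin n, {𝔫 : PrimeSpectrum (blowupAlgebra (𝔳 ^ (a + 1)) (x i)) |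
      𝔳.map (algebraMap T (blowupAlgebra (𝔳 ^ (a + 1)) (x i))) ≤ 𝔫.asIdeal ∧
        ¬ IsRegularLocalRing (Localization.AtPrime 𝔫.asIdeal)}.Finite)
    (hmodel : ∀ (i : Fin n) (𝔫 : PrimeSpectrum (blowupAlgebra (𝔳 ^ (a + 1)) (x i))),
      𝔳.map (algebraMap T (blowupAlgebra (𝔳 ^ (a + 1)) (x i))) ≤ 𝔫.asIdeal →
      ¬ IsRegularLocalRing (Localization.AtPrime 𝔫.asIdeal) →
      Scheme.IsRegular (affineBlowup (R := Localization.AtPrime 𝔫.asIdeal)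
        (maximalIdeal (Localization.AtPrime 𝔫.asIdeal)))) :
    ∃ (V : X.Opens), ι ⟨𝔭, h𝔭.isPrime⟩ ∈ V ∧
      (∀ t : X, t ∉ Scheme.regularLocus X → t ∈ V → t = ι ⟨𝔭, h𝔭.isPrime⟩) ∧
      ∃ (Y : Scheme.{0}) (ρ : Y ⟶ V), IsProper ρ ∧ Scheme.IsRegular Y ∧
        IsIso (ρ ∣_ (V.ι ⁻¹ᵁ ⟨Scheme.regularLocus X, isOpen_regularLocus_of_locallyOfFiniteType_field f⟩)) ∧
        Dense ((ρ ⁻¹ᵁ (V.ι ⁻¹ᵁ ⟨Scheme.regularLocus X,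
          isOpen_regularLocus_of_locallyOfFiniteType_field f⟩) : Y.Opens) : Set Y) := by
  classical
  -- instances on the étale side
  haveI : IsNoetherianRing B := Algebra.FiniteType.isNoetherianRing K B
  haveI : Algebra.FiniteType B C := inferInstance
  haveI : IsNoetherianRing C := Algebra.FiniteType.isNoetherianRing B C
  haveI h𝔔max : 𝔔.IsMaximal := EtaleChartTwoStep.isMaximal_of_formallyUnramified_of_comap_eq 𝔭 𝔔 h𝔔𝔭
  haveI : IsNoetherianRing (Localization.AtPrime 𝔔) :=
    IsLocalization.isNoetherianRing 𝔔.primeCompl (Localization.AtPrime 𝔔) inferInstance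
  -- unramified at `𝔔`: `𝔭 C_𝔔 = 𝔪`
  have hunr : 𝔭.map (algebraMap B (Localization.AtPrime 𝔔)) = maximalIdeal (Localization.AtPrime 𝔔) := by
    haveI : 𝔔.LiesOver 𝔭 := ⟨h𝔔𝔭.symm⟩
    letI := Localization.AtPrime.algebraOfLiesOver 𝔭 𝔔
    haveI : Algebra.IsUnramifiedAt B 𝔔 :=
      (Algebra.formallyUnramified_iff_forall).mp inferInstance ⟨𝔔, h𝔔⟩
    exact ((Algebra.isUnramifiedAt_iff_map_eq B 𝔭 𝔔).mp inferInstance).2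
  -- the centre downstairs, pushed to the completion: `(𝔭^{a+1} C) Ê' = 𝔪̂^{a+1}`
  have hfacB : algebraMap B (Localization.AtPrime 𝔔) = (algebraMap C (Localization.AtPrime 𝔔)).comp (algebraMap B C) :=
    IsScalarTower.algebraMap_eq B C _
  have hfacC : algebraMap C (AdicCompletion (maximalIdeal (Localization.AtPrime 𝔔)) (Localization.AtPrime 𝔔)) = (algebraMap (Localization.AtPrime 𝔔) (AdicCompletion (maximalIdeal (Localization.AtPrime 𝔔)) (Localization.AtPrime 𝔔))).comp (algebraMap C (Localization.AtPrime 𝔔)) :=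
    RingHom.ext fun _ => rfl
  have hcentre : ((𝔭 ^ (a + 1)).map (algebraMap B C)).map (algebraMap C (AdicCompletion (maximalIdeal (Localization.AtPrime 𝔔)) (Localization.AtPrime 𝔔))) = (maximalIdeal (AdicCompletion (maximalIdeal (Localization.AtPrime 𝔔)) (Localization.AtPrime 𝔔))) ^ (a + 1) := by
    rw [Ideal.map_pow, Ideal.map_pow, hfacC, ← Ideal.map_map, Ideal.map_map (algebraMap B C), ← hfacB, hunr,
      ← AdicCompletion.maximalIdeal_eq_map]
  -- instances on the model side
  haveI : IsNoetherianRing T := Algebra.FiniteType.isNoetherianRing κ T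
  haveI : IsNoetherianRing (Localization.AtPrime 𝔳) :=
    IsLocalization.isNoetherianRing 𝔳.primeCompl (Localization.AtPrime 𝔳) inferInstance
  haveI : IsNoetherianRing (AdicCompletion (maximalIdeal (Localization.AtPrime 𝔳)) (Localization.AtPrime 𝔳)) := isNoetherianRing_adicCompletion_maximalIdeal _
  -- singular points of the model blow-up lie over `V(𝔪̂)`
  have hReg : ∀ Q : Spec (.of (AdicCompletion (maximalIdeal (Localization.AtPrime 𝔳)) (Localization.AtPrime 𝔳))), ¬ 𝔳.map (algebraMap T _) ≤ Q.asIdeal → Q ∈ Scheme.regularLocus _ := fun Q hQ =>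
    SingularPointsOverVertex.mem_regularLocus_Spec_adicCompletion_of_not_le κ 𝔳 hoff Q hQ
  have hZ' := SingularPointsOverVertex.le_of_not_mem_regularLocus_of_pow_le
    (𝔳.map (algebraMap T (AdicCompletion (maximalIdeal (Localization.AtPrime 𝔳)) (Localization.AtPrime 𝔳)))) ((𝔳 ^ (a + 1)).map (algebraMap T _)) (n := a + 1) (by rw [Ideal.map_pow])
    (by rw [Ideal.map_pow]; exact Ideal.pow_le_self (Nat.succ_ne_zero a)) hReg
  have hZ : ∀ z : affineBlowup ((𝔳 ^ (a + 1)).map (algebraMap T (AdicCompletion (maximalIdeal (Localization.AtPrime 𝔳)) (Localization.AtPrime 𝔳)))), z ∉ Scheme.regularLocus _ →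
      𝔳 ≤ (affineBlowup.π _ z).asIdeal.comap (algebraMap T _) := fun z hz =>
    Ideal.map_le_iff_le_comap.mp (hZ' z hz)
  -- `hfin` and `hloc` on the model blow-up, from the charts
  have hfinm := CompletedBaseChangeFibreFinite.finite_compl_regularLocus_of_model_charts κ T 𝔳 x (𝔳 ^ (a + 1)) hx hfin hZ
  have hlocm : ∀ z ∈ (Scheme.regularLocus (affineBlowup ((𝔳 ^ (a + 1)).map (algebraMap T (AdicCompletion (maximalIdeal (Localization.AtPrime 𝔳)) (Localization.AtPrime 𝔳))))))ᶜ,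
      Scheme.IsRegular (affineBlowup (R := (affineBlowup ((𝔳 ^ (a + 1)).map (algebraMap T (AdicCompletion (maximalIdeal (Localization.AtPrime 𝔳)) (Localization.AtPrime 𝔳))))).presheaf.stalk z)
        (maximalIdeal _)) := fun z hz =>
    CompletedBaseChangeFibrePoints.hloc_stalk_of_model_charts κ T 𝔳 x (𝔳 ^ (a + 1)) hx hmodel z (hZ z hz)
      (by rwa [Set.mem_compl_iff, Scheme.mem_regularLocus] at hz)
  -- transport along `e`
  obtain ⟨hfin', hloc'⟩ := CompletedBaseChangeFibreTransport.hfin_hloc_of_ringEquiv e _ hfinm hlocm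
  have hJ : ((𝔳 ^ (a + 1)).map (algebraMap T (AdicCompletion (maximalIdeal (Localization.AtPrime 𝔳)) (Localization.AtPrime 𝔳)))).map (e : _ →+* _) =
      ((𝔭 ^ (a + 1)).map (algebraMap B C)).map (algebraMap C (AdicCompletion (maximalIdeal (Localization.AtPrime 𝔔)) (Localization.AtPrime 𝔔))) := by
    rw [hcentre, Ideal.map_pow, Ideal.map_pow, CompletedBaseChangeFibreFlat.map_eq_maximalIdeal_adicCompletion T 𝔳,
      PointBlowupOfCompletion.map_maximalIdeal_ringEquiv e]
  rw [hJ] at hfin' hloc'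
  -- DOWN through the completion to `Bl_{𝔭^{a+1}C}(Spec C)` over `V(𝔔)`
  obtain ⟨m, y, hy⟩ := Submodule.fg_iff_exists_fin_generating_family.mp (IsNoetherian.noetherian (𝔭 ^ (a + 1)))
  have hIC : (𝔭 ^ (a + 1)).map (algebraMap B C) = Ideal.span (Set.range ((algebraMap B C) ∘ y)) := by
    rw [← hy, Ideal.submodule_span_eq, Ideal.map_span, ← Set.range_comp]
  have hdown_loc : ∀ z : affineBlowup ((𝔭 ^ (a + 1)).map (algebraMap B C)),
      𝔔 ≤ (affineBlowup.π ((𝔭 ^ (a + 1)).map (algebraMap B C)) z).asIdeal →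
      ¬ IsRegularLocalRing ((affineBlowup ((𝔭 ^ (a + 1)).map (algebraMap B C))).presheaf.stalk z) →
      Scheme.IsRegular (affineBlowup (R := (affineBlowup ((𝔭 ^ (a + 1)).map (algebraMap B C))).presheaf.stalk z)
        (maximalIdeal _)) :=
    fun z hz𝔔' hz => CompletedBaseChangeFibreDownCompletion.hloc_stalk_down_completion C 𝔔 ((algebraMap B C) ∘ y)
      ((𝔭 ^ (a + 1)).map (algebraMap B C)) hIC (fun w hw => hloc' w hw) z hz𝔔' hz
  have hdown_fin := CompletedBaseChangeFibreDownCompletion.finite_singular_over_of_finite_completion C 𝔔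
    ((algebraMap B C) ∘ y) ((𝔭 ^ (a + 1)).map (algebraMap B C)) hIC hfin'
  exact hloc_of_two_step_etale_ring_data_of_down K X f ι hι 𝔭 h𝔭0 hsing hregB 𝔔 h𝔔𝔭 a hdown_fin hdown_loc

end Summit.ResolutionOfSingularities.ResolutionOfSingularities.Theorems.FRationalResolution.EtaleChartTwoStepModel

end
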